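import Literature.NumberTheory.EllipticCurves.DeligneSerreSpanHeckeDualityProofs
import Literature.NumberTheory.EllipticCurves.CuspFormEpsConj
import Mathlib.LinearAlgebra.Dual.Lemmas
import Mathlib.LinearAlgebra.Complex.Module
import HarnessLib

/-!
# Deligne–Serre 1974, (2.7.2): Shimura's Thm. 3.48 (2) from the full Hecke-stable lattice
# (3.5.20) and the real structure `f ↦ f^ε` — the Eichler–Shimura input isolated

The named fact `DeligneSerre1974_span_integralLattice1 N k`
(`Literature.NumberTheory.EllipticCurves.NewformGaloisRepIntegralityProofs`; Deligne–Serre 1974,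
Prop. 2.7 (2.7.2): the lattice `L` of cusp forms on `Γ₁(N)` all of whose diamond twists have
integral `q`-expansion spans `S_k(Γ₁(N))`) has been reduced in the tree to a single statement
about the Hecke ring `𝕋_ℤ = ℤ[T_p, ⟨d⟩]` of `S_{n+2}(Γ₁(N))` (`heckeRing1`):

* `DeligneSerreProp27WeightReductionProofs`: all weights follow from the weights `≥ 2`
  (`DeligneSerre1974_span_integralLattice1.of_two_le`, division by `E₄`, `E₆`);
* `DeligneSerreSpanHeckeDualityProofs`: in weight `n + 2`, (2.7.2) follows from — and is
  equivalent to — **Shimura 1971, Thm. 3.48 (2)** for `𝕋_ℤ`: *`ℤ`-linearly independent families in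
  `𝕋_ℤ` are `ℂ`-linearly independent* (`span_integralLattice1_of_linearIndependent`,
  `DeligneSerre1974_span_integralLattice1_of_linearIndependent`; Shimura's Thm. 3.51 and Thm. 3.52
  are proved there).

This file proves Thm. 3.48 (2) itself by **Shimura's argument** (proof of Thm. 3.48, pp. 83–84),
from the one statement of his that the tree does not have — the **full-rank Hecke-stable lattice
(3.5.20)**, which Shimura obtains in §8.4 from the Eichler–Shimura isomorphism — entered, following
D-0026, not as a named fact but as the explicit hypothesis structure `HeckeStableRealLattice N k`:
an `ℝ`-basis of `S_k(Γ₁(N))^∨` whose `ℤ`-span is stable under all `T_p^∨` and `⟨d⟩^∨` ((3.5.20)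
transposed).  This is the shape in which the tree states and proves its Eichler–Shimura lattices:
`periodHomology_eq_span_basis` (`Γ₀(N)`, `k = 2`; discharged) and the period lattice
`periodLatticeK1` of `EichlerShimuraPeriodsGamma1` (`Γ₁(N)`, `k ≥ 2`; proved finitely generated,
`T_p^∨`/`⟨d⟩^∨`-stable and separating, but not yet of full rank).  **Discharging
`DeligneSerre1974_span_integralLattice1` (and Deligne–Serre (2.7.4), `prop27_conj`) is thereby
reduced to inhabiting `HeckeStableRealLattice N (n + 2)` for all `N` and `n`**, i.e. to the rank
statement `rank_ℤ Λ = 2 dim_ℂ S_k(Γ₁(N))` of the Eichler–Shimura isomorphism (Shimura Thm. 8.4,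
(8.2.23)).

## The argument (Shimura 1971, proof of Thm. 3.48 (2), for `Γ' = Γ₁(N)`)

1. *`ℤ`-independent elements of `𝕋_ℤ` are `ℝ`-independent*: given a full lattice
   `Λ = ℤb₁ ⊕ ⋯ ⊕ ℤb_{2r} ⊆ V^∨` (`b` an `ℝ`-basis) stable under the transposes of `𝕋_ℤ`
   (`dualMap_mem_of_mem_heckeRing1`), the elements of `𝕋_ℤ` act on `Λ` by integer matrices, and
   `ℤ`-independent integer matrices are `ℝ`-independent (`RealLattice.linearIndependent_real_of_int`:
   apply a `ℚ`-linear `π : ℝ → ℚ` to a real relation and clear denominators) — Shimura: "let `V` be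
   the `ℚ`-linear span of `L`. Then `S_k(Γ') = V ⊗_ℚ ℝ` … elements of `B₀` are linearly independent
   over `ℚ` if and only if they are so over `ℝ`".
2. *`ℝ`-independent elements of `𝕋_ℤ` are `ℂ`-independent*: `𝕋_ℤ` commutes with the
   conjugate-linear involution `f ↦ f^ε = \overline{f(-z̄)}` (`epsConj` of `CuspFormEpsConj`;
   `epsConj_apply_of_mem_heckeRing1`), so a complex relation `∑ cⱼTⱼ = 0` gives `∑ c̄ⱼTⱼ = 0` and
   hence real relations for `re cⱼ`, `im cⱼ` (`RealLattice.linearIndependent_complex_of_real`) —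
   Shimura: "`W = {f ∈ S_k(Γ') | f^ε = f}` … `End(S_k(Γ'), ℂ) = End(W, ℝ) ⊗_ℝ ℂ`, we see that
   elements of `B₁` are linearly independent over `ℝ` if and only if they are so over `ℂ`".

Both steps are genuinely needed: without the real structure the statement fails (Shimura,
Rem. 3.50: for `R(Γ(6), Δ)` on `S₂(Γ(6))` the `ℚ`-span is two-dimensional, the `ℂ`-span
one-dimensional); without a full lattice it fails abstractly (`ℤ[√2]` acting on `ℂ` preserves the
finitely generated, separating, spanning "lattice" `ℤ[√2] ⊆ ℂ^∨`).

## Results (all proved; no named facts)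

* `RealLattice.linearIndependent_real_of_int`, `RealLattice.linearIndependent_complex_of_real` —
  the two abstract steps.
* `epsConj_apply_of_mem_heckeRing1` (`𝕋_ℤ` commutes with `ε`), `dualMap_mem_of_mem_heckeRing1`
  (a `ℤ`-submodule of the dual stable under the `T_p^∨`, `⟨d⟩^∨` is stable under `𝕋_ℤ^∨`).
* `linearIndependent_complex_of_int_of_realBasis` — **Thm. 3.48 (2) for `𝕋_ℤ` from a full
  Hecke-stable lattice in `S_k(Γ₁(N))^∨`** (any weight `k`).
* `HeckeStableRealLattice N k` — **hypothesis structure** (Shimura 1971, (3.5.20) with Thm. 8.4,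
  Prop. 8.5–8.6, dual form), and from it: `HeckeStableRealLattice.linearIndependent_complex`
  (Thm. 3.48 (2)), `HeckeStableRealLattice.span_integralLattice1_eq_top` ((2.7.2) in weight `n + 2`),
  `DeligneSerre1974_span_integralLattice1_of_forall_heckeStableRealLattice` (**(2.7.2) in every
  weight, weight one included**), `IsNewform1.exists_map_eq_heckePolynomial_of_forall_heckeStableRealLattice`
  (integrality of the Hecke polynomial of a newform of any weight) and
  `DeligneSerre1974.prop27_conj_of_forall_heckeStableRealLattice` (Deligne–Serre (2.7.4)).
* `nonempty_heckeStableRealLattice_of_periodLatticeK1_eq_span`,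
  `DeligneSerre1974_span_integralLattice1_of_forall_periodLatticeK1_eq_span` — the remaining target
  made explicit: it suffices that the period lattice `periodLatticeK1 n` be the `ℤ`-span of an
  `ℝ`-basis of `S_{n+2}(Γ₁(N))^∨` for every `n` (the `Γ₁(N)` analogue of the discharged
  `periodHomology_eq_span_basis`; Shimura Thm. 8.4 / Prop. 8.6).

## References

* G. Shimura, *Introduction to the arithmetic theory of automorphic functions*, Publ. Math. Soc.
  Japan 11 (1971): (3.3.2), Thm. 3.48 and its proof (`f^ε`, `W`, `B₁ = B₀ ⊗ ℝ`), Lemma 3.49,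
  Rem. 3.50, (3.5.20), Thm. 3.51, Thm. 3.52 (pp. 83–86); Thm. 8.4, Prop. 8.5, Prop. 8.6 (§8.4).
* P. Deligne, J.-P. Serre, *Formes modulaires de poids 1*, Ann. Sci. ÉNS (4) 7 (1974), Prop. 2.7,
  Rem. 2.8 (p. 512).
* F. Diamond, J. Shurman, *A first course in modular forms*, GTM 228 (2005), §6.5–6.6 (the lattice
  `H₁(X₁(N), ℤ)`, `𝕋_ℤ` finitely generated, `S₂(Γ₁(N))` has an integral basis).
-/

noncomputable section

open scoped MatrixGroups ModularForm ComplexConjugate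

open CongruenceSubgroup UpperHalfPlane

namespace Literature.NumberTheory.EllipticCurves.ModularForms

/-! ## 1. Linear algebra: full lattices and real structures (Shimura 1971, proof of Thm. 3.48 (2)) -/

namespace RealLattice

/-- **`ℤ`-independent endomorphisms preserving a full lattice are `ℝ`-independent** (Shimura 1971,
proof of Thm. 3.48: "let `V` be the `ℚ`-linear span of `L`. Then `S_k(Γ') = V ⊗_ℚ ℝ`, and hence
`End(S_k(Γ'), ℝ) = End(V, ℚ) ⊗_ℚ ℝ`. Therefore elements of `B₀` are linearly independent over `ℚ`
if and only if they are so over `ℝ`").  Here `b` is an `ℝ`-basis of `W`, the `Tⱼ` map each `b i`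
into `Λ = ⊕ ℤ bᵢ`, i.e. act by integer matrices; a real relation `∑ cⱼ Tⱼ = 0` is a family of real
relations among integer vectors, which a `ℚ`-linear `π : ℝ → ℚ` with `π(c_{j₀}) ≠ 0` turns (after
clearing denominators) into a non-trivial integer relation. [cite: Shimura1971, proof of Thm. 3.48 (2)] -/
theorem linearIndependent_real_of_int {W : Type*} [AddCommGroup W] [Module ℝ W] {ι κ : Type*}
    [Fintype ι] [Fintype κ] (b : Module.Basis ι ℝ W) (T : κ → (W →ₗ[ℝ] W))
    (hT : ∀ j i, T j (b i) ∈ Submodule.span ℤ (Set.range b)) (hind : LinearIndependent ℤ T) :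
    LinearIndependent ℝ T := by
  classical
  -- integer matrices `n j i l = (b-coordinate l of T j (b i))`
  have hn : ∀ j i l, ∃ n : ℤ, (n : ℝ) = b.repr (T j (b i)) l := by
    intro j i l
    obtain ⟨n, hn⟩ := (b.mem_span_iff_repr_mem ℤ (T j (b i))).mp (hT j i) l
    exact ⟨n, by simpa using hn⟩
  choose n hn using hn
  rw [Fintype.linearIndependent_iff]
  intro c hc j₀
  by_contra hne
  obtain ⟨π, hπ⟩ := Module.Projective.exists_dual_ne_zero ℚ hne
  -- the real relations among the integer vectors
  have hrel : ∀ i l, ∑ j, c j * n j i l = 0 := by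
    intro i l
    have := congrArg (fun S : W →ₗ[ℝ] W ↦ b.repr (S (b i)) l) hc
    simpa [map_sum, ← hn] using this
  -- apply `π`
  have hrelQ : ∀ i l, ∑ j, (n j i l : ℚ) * π (c j) = 0 := by
    intro i l
    have := congrArg π (hrel i l)
    rw [map_sum, map_zero] at this
    rw [← this]
    refine Finset.sum_congr rfl fun j _ ↦ ?_
    rw [mul_comm (c j), ← zsmul_eq_mul (c j), map_zsmul, zsmul_eq_mul]
  -- clear denominators
  set D : ℕ := ∏ j, (π (c j)).den with hD
  have hD0 : (D : ℚ) ≠ 0 := by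
    rw [Nat.cast_ne_zero, hD]
    exact Finset.prod_ne_zero_iff.mpr fun j _ ↦ (π (c j)).den_ne_zero
  have hz : ∀ j, ∃ z : ℤ, (z : ℚ) = D * π (c j) := by
    intro j
    obtain ⟨m, hm⟩ : (π (c j)).den ∣ D := Finset.dvd_prod_of_mem _ (Finset.mem_univ j)
    refine ⟨m * (π (c j)).num, ?_⟩
    rw [hm]
    push_cast
    rw [← Rat.mul_den_eq_num (π (c j))]
    ring
  choose z hz using hz
  -- the integer relation `∑ z j • T j = 0`
  have hzT : ∑ j, z j • T j = 0 := by
    refine b.ext fun i ↦ b.repr.injective (Finsupp.ext fun l ↦ ?_)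
    have h1 : ((∑ j, z j * n j i l : ℤ) : ℚ) = 0 := by
      push_cast
      simp_rw [hz, mul_assoc, ← Finset.mul_sum, mul_comm (π _)]
      rw [hrelQ i l, mul_zero]
    have h2 : (∑ j, z j * n j i l : ℤ) = 0 := by exact_mod_cast h1
    have h3 : ((∑ j, z j * n j i l : ℤ) : ℝ) = 0 := by rw [h2, Int.cast_zero]
    push_cast at h3
    simp_rw [hn] at h3
    simpa [map_sum] using h3
  have hz0 : z j₀ = 0 := Fintype.linearIndependent_iff.mp hind z hzT j₀
  have : (D : ℚ) * π (c j₀) = 0 := by rw [← hz j₀, hz0, Int.cast_zero]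
  exact hπ ((mul_eq_zero.mp this).resolve_left hD0)

/-- **`ℝ`-independent operators commuting with a conjugate-linear injection are `ℂ`-independent**
(Shimura 1971, proof of Thm. 3.48: with `W = {f = f^ε}`, "`End(S_k(Γ'), ℂ) = End(W, ℝ) ⊗_ℝ ℂ`, we
see that elements of `B₁` are linearly independent over `ℝ` if and only if they are so over `ℂ`").
Directly: if `∑ cⱼ Tⱼ = 0` then `ε(∑ c̄ⱼ Tⱼ x) = ∑ cⱼ Tⱼ (ε x) = 0`, so `∑ c̄ⱼ Tⱼ = 0`, whence the
real relations `∑ (re cⱼ) Tⱼ = 0 = ∑ (im cⱼ) Tⱼ`. [cite: Shimura1971, proof of Thm. 3.48 (2)] -/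
theorem linearIndependent_complex_of_real {V : Type*} [AddCommGroup V] [Module ℂ V] {κ : Type*}
    [Fintype κ] (T : κ → Module.End ℂ V) (ε : V →+ V) (hε : Function.Injective ε)
    (hεs : ∀ (c : ℂ) (x : V), ε (c • x) = conj c • ε x) (hcomm : ∀ j x, ε (T j x) = T j (ε x))
    (hind : LinearIndependent ℝ T) : LinearIndependent ℂ T := by
  rw [Fintype.linearIndependent_iff] at hind ⊢
  intro c hc
  have h1 : ∀ x, ∑ j, c j • T j x = 0 := fun x ↦ by
    simpa using congrArg (fun S : Module.End ℂ V ↦ S x) hc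
  have h2 : ∑ j, conj (c j) • T j = 0 := by
    ext x
    apply hε
    rw [LinearMap.zero_apply, map_zero, LinearMap.sum_apply, map_sum]
    simp only [LinearMap.smul_apply, hεs, Complex.conj_conj, hcomm]
    exact h1 (ε x)
  have hre : ∑ j, (c j).re • T j = 0 := by
    have : ∀ j, (c j).re • T j = (2⁻¹ : ℂ) • (c j • T j + conj (c j) • T j) := by
      intro j
      rw [← Complex.coe_smul, Complex.re_eq_add_conj, ← add_smul, div_eq_inv_mul, mul_smul]
    simp_rw [this, ← Finset.smul_sum, Finset.sum_add_distrib, hc, h2, add_zero, smul_zero]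
  have him : ∑ j, (c j).im • T j = 0 := by
    have : ∀ j, (c j).im • T j = (2 * Complex.I)⁻¹ • (c j • T j - conj (c j) • T j) := by
      intro j
      rw [← Complex.coe_smul, Complex.im_eq_sub_conj, ← sub_smul, div_eq_inv_mul, mul_smul]
    simp_rw [this, ← Finset.smul_sum, Finset.sum_sub_distrib, hc, h2, sub_zero, smul_zero]
  intro j
  apply Complex.ext
  · simpa using hind _ hre j
  · simpa using hind _ him j

end RealLattice

/-! ## 2. The Hecke ring `𝕋_ℤ` commutes with `ε` and acts on stable lattices of the dual -/

section HeckeRing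

variable (N : ℕ) [NeZero N] (k : ℤ)

/-- **`𝕋_ℤ` commutes with `ε`**: `(T f)^ε = T f^ε` for every `T ∈ 𝕋_ℤ = heckeRing1 N k` (from
`epsConj_heckeT`, `epsConj_diamondOp`; Shimura 1971, proof of Thm. 3.48: `f^ε|[X]_k = (f|[X^ε]_k)^ε`,
"`W` is stable under `B₁`"). [cite: Shimura1971, proof of Thm. 3.48] -/
theorem epsConj_apply_of_mem_heckeRing1 {T : Module.End ℂ (CuspForm (Gamma1 N) k)}
    (hT : T ∈ heckeRing1 N k) (f : CuspForm (Gamma1 N) k) : epsConj (T f) = T (epsConj f) := by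
  induction hT using Algebra.adjoin_induction generalizing f with
  | mem x hx =>
    rcases hx with ⟨p, hp, rfl⟩ | ⟨d, rfl⟩
    · haveI : NeZero p := ⟨hp.ne_zero⟩
      exact epsConj_heckeT p hp f
    · exact epsConj_diamondOp (d : ZMod N) f
  | algebraMap z =>
    rw [Module.algebraMap_end_apply, Module.algebraMap_end_apply, ← Int.cast_smul_eq_zsmul ℂ,
      ← Int.cast_smul_eq_zsmul ℂ, epsConj_smul, map_intCast]
  | add x y _ _ hx hy => rw [LinearMap.add_apply, LinearMap.add_apply, epsConj_add, hx, hy]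
  | mul x y _ _ hx hy => rw [Module.End.mul_apply, Module.End.mul_apply, hx, hy]

/-- If the transposes of the generators `T_p`, `⟨d⟩` map a `ℤ`-submodule `Λ ⊆ S_k(Γ₁(N))^∨` into
itself, so does the transpose of every `T ∈ 𝕋_ℤ` (cf. `dualMap_mem_periodLatticeK1_of_mem_heckeRing1`
for the period lattice). [folklore] -/
theorem dualMap_mem_of_mem_heckeRing1
    (Λ : Submodule ℤ (Module.Dual ℂ (CuspForm (Gamma1 N) k)))
    (hTp : ∀ (p : ℕ) (hp : p.Prime), ∀ φ ∈ Λ,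
      (haveI : NeZero p := ⟨hp.ne_zero⟩; (heckeT (Gamma1 N) k p).dualMap φ) ∈ Λ)
    (hd : ∀ (d : (ZMod N)ˣ), ∀ φ ∈ Λ, (diamondOp N k (d : ZMod N)).dualMap φ ∈ Λ)
    {T : Module.End ℂ (CuspForm (Gamma1 N) k)} (hT : T ∈ heckeRing1 N k) :
    ∀ φ ∈ Λ, T.dualMap φ ∈ Λ := by
  induction hT using Algebra.adjoin_induction with
  | mem x hx =>
    rcases hx with ⟨p, hp, rfl⟩ | ⟨d, rfl⟩
    · exact hTp p hp
    · exact hd d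
  | algebraMap z =>
    intro φ hφ
    have : (algebraMap ℤ (Module.End ℂ (CuspForm (Gamma1 N) k)) z).dualMap φ = z • φ := by
      ext v
      rw [LinearMap.dualMap_apply, Module.algebraMap_end_apply, LinearMap.smul_apply, map_zsmul]
    rw [this]
    exact Λ.smul_mem z hφ
  | add x y _ _ hx hy =>
    intro φ hφ
    have : (x + y).dualMap φ = x.dualMap φ + y.dualMap φ := by
      ext v
      simp [LinearMap.dualMap_apply]
    rw [this]
    exact Λ.add_mem (hx φ hφ) (hy φ hφ)
  | mul x y _ _ hx hy =>
    intro φ hφ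
    have : (x * y).dualMap φ = y.dualMap (x.dualMap φ) := by
      ext v
      simp [LinearMap.dualMap_apply]
    rw [this]
    exact hy _ (hx φ hφ)

end HeckeRing

/-! ## 3. Thm. 3.48 (2) for `𝕋_ℤ` from a full Hecke-stable lattice in `S_k(Γ₁(N))^∨` -/

section RealBasis

variable (N : ℕ) [NeZero N] (k : ℤ)

/-- **Shimura 1971, Thm. 3.48 (2) for `𝕋_ℤ`, finite families**: given an `ℝ`-basis `b` of
`S_k(Γ₁(N))^∨` whose `ℤ`-span is stable under all `T_p^∨` and `⟨d⟩^∨`, every `ℤ`-linearly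
independent finite family in `𝕋_ℤ` is `ℂ`-linearly independent (`B = B₀ ⊗_ℚ ℂ`).  Steps 1 and 2
of the module docstring: the transposes act on `⊕ ℤbᵢ` by integer matrices
(`RealLattice.linearIndependent_real_of_int`), and `𝕋_ℤ` commutes with `ε`
(`RealLattice.linearIndependent_complex_of_real`, `epsConj_apply_of_mem_heckeRing1`). [cite: Shimura1971, Thm. 3.48 (2)] -/
theorem linearIndependent_complex_of_int_of_realBasis {ι : Type*} [Fintype ι]
    (b : Module.Basis ι ℝ (Module.Dual ℂ (CuspForm (Gamma1 N) k)))
    (hTp : ∀ (p : ℕ) (hp : p.Prime), ∀ φ ∈ Submodule.span ℤ (Set.range b),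
      (haveI : NeZero p := ⟨hp.ne_zero⟩; (heckeT (Gamma1 N) k p).dualMap φ) ∈
        Submodule.span ℤ (Set.range b))
    (hd : ∀ d : (ZMod N)ˣ, ∀ φ ∈ Submodule.span ℤ (Set.range b),
      (diamondOp N k (d : ZMod N)).dualMap φ ∈ Submodule.span ℤ (Set.range b))
    {κ : Type*} [Fintype κ] (S : κ → Module.End ℂ (CuspForm (Gamma1 N) k))
    (hS : ∀ j, S j ∈ heckeRing1 N k) (hind : LinearIndependent ℤ S) :
    LinearIndependent ℂ S := by
  -- the transposes, as `ℝ`-linear endomorphisms of the dual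
  let T : κ → (Module.Dual ℂ (CuspForm (Gamma1 N) k) →ₗ[ℝ] Module.Dual ℂ (CuspForm (Gamma1 N) k)) :=
    fun j ↦ (S j).dualMap.restrictScalars ℝ
  have hT : ∀ j i, T j (b i) ∈ Submodule.span ℤ (Set.range b) := fun j i ↦
    dualMap_mem_of_mem_heckeRing1 N k _ hTp hd (hS j) _ (Submodule.subset_span ⟨i, rfl⟩)
  -- `ℤ`-independence of the transposes
  have hTind : LinearIndependent ℤ T := by
    rw [Fintype.linearIndependent_iff] at hind ⊢
    intro z hz
    refine hind z (LinearMap.ext fun f ↦ ?_)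
    rw [LinearMap.zero_apply]
    refine (Module.forall_dual_apply_eq_zero_iff ℂ _).mp fun φ ↦ ?_
    have := congrArg
      (fun R : Module.Dual ℂ (CuspForm (Gamma1 N) k) →ₗ[ℝ] Module.Dual ℂ (CuspForm (Gamma1 N) k) ↦
        R φ f) hz
    simpa [T, LinearMap.dualMap_apply, map_sum] using this
  have hTR : LinearIndependent ℝ T := RealLattice.linearIndependent_real_of_int b T hT hTind
  -- `ℝ`-independence of `S`
  have hSR : LinearIndependent ℝ S := by
    rw [Fintype.linearIndependent_iff] at hTR ⊢
    intro c hc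
    refine hTR c (LinearMap.ext fun φ ↦ LinearMap.ext fun f ↦ ?_)
    have := congrArg (fun R : Module.End ℂ (CuspForm (Gamma1 N) k) ↦ φ (R f)) hc
    simpa [T, LinearMap.dualMap_apply, map_sum, ← Complex.coe_smul] using this
  -- `ℂ`-independence via `ε`
  let E : CuspForm (Gamma1 N) k →+ CuspForm (Gamma1 N) k :=
    { toFun := epsConj, map_zero' := epsConj_zero, map_add' := epsConj_add }
  exact RealLattice.linearIndependent_complex_of_real S E epsConj_injective
    (fun c x ↦ epsConj_smul c x) (fun j x ↦ epsConj_apply_of_mem_heckeRing1 N k (hS j) x) hSR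

/-- **Shimura 1971, Thm. 3.48 (2) for `𝕋_ℤ`** (arbitrary families): as
`linearIndependent_complex_of_int_of_realBasis`, for families indexed by any type (linear
independence is a property of the finite subfamilies). [cite: Shimura1971, Thm. 3.48 (2)] -/
theorem linearIndependent_complex_of_int_of_realBasis' {ι : Type*} [Fintype ι]
    (b : Module.Basis ι ℝ (Module.Dual ℂ (CuspForm (Gamma1 N) k)))
    (hTp : ∀ (p : ℕ) (hp : p.Prime), ∀ φ ∈ Submodule.span ℤ (Set.range b),
      (haveI : NeZero p := ⟨hp.ne_zero⟩; (heckeT (Gamma1 N) k p).dualMap φ) ∈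
        Submodule.span ℤ (Set.range b))
    (hd : ∀ d : (ZMod N)ˣ, ∀ φ ∈ Submodule.span ℤ (Set.range b),
      (diamondOp N k (d : ZMod N)).dualMap φ ∈ Submodule.span ℤ (Set.range b))
    {κ : Type*} (S : κ → Module.End ℂ (CuspForm (Gamma1 N) k))
    (hS : ∀ j, S j ∈ heckeRing1 N k) (hind : LinearIndependent ℤ S) :
    LinearIndependent ℂ S := by
  rw [linearIndependent_iff_finset_linearIndependent] at hind ⊢
  intro s
  exact linearIndependent_complex_of_int_of_realBasis N k b hTp hd _ (fun j ↦ hS j) (hind s)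

end RealBasis

/-! ## 4. Shimura's (3.5.20) as a hypothesis structure, and Deligne–Serre (2.7.2) in every weight -/

section Lattice

variable (N : ℕ) [NeZero N] (k : ℤ)

/-- **A full Hecke-stable lattice in `S_k(Γ₁(N))^∨`** — the content of Shimura 1971, (3.5.20) for
`Γ' = Γ₁(N)`, as a hypothesis structure (data; D-0026: no named fact is introduced, the
Eichler–Shimura input of this file is an explicit hypothesis).  Shimura, *Introduction to the
arithmetic theory of automorphic functions*, (3.5.20) (p. 84), for `Γ'` of type (3.3.2) —
`Γ' = {(a b; c d) ∈ SL₂(ℤ) | a ∈ 𝔥, b ≡ 0 (t), c ≡ 0 (N)}`, `Γ₁(N)` being the case `t = 1`, `𝔥 = {1}` —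
and `k ≥ 2`: *"There is a discrete `ℤ`-submodule `L` of `S_k(Γ')` of maximal rank which is stable
under the `[Γ'αΓ']_k` for all `α ∈ Δ`"* (`Δ = M₂(ℤ) ∩ GL₂⁺(ℝ)`), proved in §8.4 from the
Eichler–Shimura isomorphism (Thm. 8.4), its Hecke equivariance (Prop. 8.5) and the integral
parabolic cohomology (Prop. 8.6).  "Discrete of maximal rank" in the `2r`-dimensional real vector
space `S_k(Γ')` means: the `ℤ`-span of an `ℝ`-basis.  The structure records the **dual** lattice,
restricted to the operators of the tree: an `ℝ`-basis `b` of `S_k(Γ₁(N))^∨` whose `ℤ`-span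
`⊕ᵢ ℤbᵢ` is mapped into itself by the transposes of the `T_p` (`heckeT (Gamma1 N) k p`, all primes
`p`; Shimura's `[Γ' diag(1,p) Γ']_k` in the same normalisation, see the module docstring of
`HeckeIntegrality`; `diag(1,p) ∈ Δ` also for `p ∣ N`) and of the `⟨d⟩` (`= [Γ' σ_d Γ']_k`,
`σ_d ∈ Γ₀(N) ⊆ Δ`).  Shimura's `L` yields such data by duality — `{φ | re φ(L) ⊆ ℤ} ≅ Hom_ℤ(L, ℤ)` is a
full lattice of `S_k^∨` (through the `ℝ`-isomorphism `φ ↦ re ∘ φ`, `Hom_ℂ(S_k, ℂ) ≅ Hom_ℝ(S_k, ℝ)`)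
stable under the transposes — and it is the shape in which the tree states its Eichler–Shimura
lattices: `periodHomology_eq_span_basis` (`Γ₀(N)`, `k = 2`, discharged) and the period lattice
`periodLatticeK1` of `EichlerShimuraPeriodsGamma1` (`Γ₁(N)`, `k ≥ 2`; proved finitely generated,
`T_p^∨`/`⟨d⟩^∨`-stable and separating — an inhabitant of this structure as soon as its rank is shown
to be `2 dim_ℂ S_k(Γ₁(N))`, i.e. the dimension count `dim_ℝ H¹_P = 2 dim S_k` of Thm. 8.4 / (8.2.23)).
[cite: Shimura1971, (3.5.20) (proof of Thm. 3.48; proved in §8.4 from Thm. 8.4, Prop. 8.5, Prop. 8.6)] -/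
structure HeckeStableRealLattice where
  /-- The rank of the lattice (for an inhabitant necessarily `2 dim_ℂ S_k(Γ₁(N))`). -/
  rank : ℕ
  /-- An `ℝ`-basis of the dual space `S_k(Γ₁(N))^∨`; the lattice is its `ℤ`-span. -/
  basis : Module.Basis (Fin rank) ℝ (Module.Dual ℂ (CuspForm (Gamma1 N) k))
  /-- The `ℤ`-span of the basis is stable under `T_p^∨` for every prime `p`. -/
  dualMap_heckeT_mem : ∀ (p : ℕ) (hp : p.Prime) (i : Fin rank),
    (haveI : NeZero p := ⟨hp.ne_zero⟩; (heckeT (Gamma1 N) k p).dualMap (basis i)) ∈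
      Submodule.span ℤ (Set.range basis)
  /-- The `ℤ`-span of the basis is stable under `⟨d⟩^∨` for every unit `d`. -/
  dualMap_diamondOp_mem : ∀ (d : (ZMod N)ˣ) (i : Fin rank),
    (diamondOp N k (d : ZMod N)).dualMap (basis i) ∈ Submodule.span ℤ (Set.range basis)

namespace HeckeStableRealLattice

variable {N k} (Λ : HeckeStableRealLattice N k)

/-- The lattice `⊕ᵢ ℤbᵢ ⊆ S_k(Γ₁(N))^∨` of a `HeckeStableRealLattice`. [folklore] -/
def lattice : Submodule ℤ (Module.Dual ℂ (CuspForm (Gamma1 N) k)) :=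
  Submodule.span ℤ (Set.range Λ.basis)

/-- The lattice is stable under `T_p^∨`, `p` prime (from the stability on basis vectors). [folklore] -/
theorem dualMap_heckeT_mem_lattice (p : ℕ) (hp : p.Prime) :
    ∀ φ ∈ Λ.lattice, (haveI : NeZero p := ⟨hp.ne_zero⟩; (heckeT (Gamma1 N) k p).dualMap φ) ∈
      Λ.lattice := by
  intro φ hφ
  haveI : NeZero p := ⟨hp.ne_zero⟩
  induction hφ using Submodule.span_induction with
  | mem x hx =>
    obtain ⟨i, rfl⟩ := hx
    exact Λ.dualMap_heckeT_mem p hp i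
  | zero => simp
  | add x y _ _ hx hy =>
    rw [map_add]
    exact add_mem hx hy
  | smul z x _ hx =>
    rw [map_zsmul]
    exact Submodule.smul_mem _ z hx

/-- The lattice is stable under `⟨d⟩^∨`, `d` a unit. [folklore] -/
theorem dualMap_diamondOp_mem_lattice (d : (ZMod N)ˣ) :
    ∀ φ ∈ Λ.lattice, (diamondOp N k (d : ZMod N)).dualMap φ ∈ Λ.lattice := by
  intro φ hφ
  induction hφ using Submodule.span_induction with
  | mem x hx =>
    obtain ⟨i, rfl⟩ := hx
    exact Λ.dualMap_diamondOp_mem d i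
  | zero => simp
  | add x y _ _ hx hy =>
    rw [map_add]
    exact add_mem hx hy
  | smul z x _ hx =>
    rw [map_zsmul]
    exact Submodule.smul_mem _ z hx

/-- **Shimura 1971, Thm. 3.48 (2) for `𝕋_ℤ` from (3.5.20)**: given a full Hecke-stable lattice in
`S_k(Γ₁(N))^∨`, `ℤ`-linearly independent families in `𝕋_ℤ` are `ℂ`-linearly independent — the
hypothesis of `span_integralLattice1_of_linearIndependent` /
`DeligneSerre1974_span_integralLattice1_of_linearIndependent` (`DeligneSerreSpanHeckeDualityProofs`).
[cite: Shimura1971, Thm. 3.48 (2)] -/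
theorem linearIndependent_complex (Λ : HeckeStableRealLattice N k) {ι : Type*}
    (v : ι → Module.End ℂ (CuspForm (Gamma1 N) k)) (hv : ∀ i, v i ∈ heckeRing1 N k)
    (hli : LinearIndependent ℤ v) : LinearIndependent ℂ v :=
  linearIndependent_complex_of_int_of_realBasis' N k Λ.basis Λ.dualMap_heckeT_mem_lattice
    Λ.dualMap_diamondOp_mem_lattice v hv hli

/-- **Shimura 1971, Thm. 3.52 with diamond twists = Deligne–Serre (2.7.2), in weight `n + 2`, from a
full Hecke-stable lattice in that weight**: `span_ℂ L = S_{n+2}(Γ₁(N))` (by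
`span_integralLattice1_of_linearIndependent` of `DeligneSerreSpanHeckeDualityProofs`). [cite: Shimura1971, Thm. 3.52] -/
theorem span_integralLattice1_eq_top {n : ℕ} (Λ : HeckeStableRealLattice N (n + 2)) :
    Submodule.span ℂ (integralLattice1 N (n + 2) : Set (CuspForm (Gamma1 N) (n + 2))) = ⊤ :=
  span_integralLattice1_of_linearIndependent N n fun v hv hli ↦ Λ.linearIndependent_complex v hv hli

end HeckeStableRealLattice

variable {N k}

/-- **Deligne–Serre 1974, (2.7.2) in a weight `k ≥ 2` from a full Hecke-stable lattice in weight `k`**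
(Deligne–Serre, Rem. 2.8: "On aurait également pu utiliser le théorème 3.52 de Shimura, valable
lorsque `k ≥ 2`"). [cite: DeligneSerreASENS1974, Prop. 2.7 (2.7.2) and Rem. 2.8] -/
theorem DeligneSerre1974_span_integralLattice1_of_heckeStableRealLattice (hk : 2 ≤ k)
    (Λ : HeckeStableRealLattice N k) : DeligneSerre1974_span_integralLattice1 N k := by
  obtain ⟨n, rfl⟩ : ∃ n : ℕ, k = (n : ℤ) + 2 := ⟨(k - 2).toNat, by omega⟩
  exact fun _ ↦ Λ.span_integralLattice1_eq_top

variable (N) in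
/-- **Deligne–Serre 1974, (2.7.2) in every weight — weight one included — from full Hecke-stable
lattices in all weights `≥ 2`** (the range of Shimura's (3.5.20)): by
`DeligneSerre1974_span_integralLattice1_of_linearIndependent` (`DeligneSerreSpanHeckeDualityProofs`:
weights `≥ 2` by Thm. 3.52, then every weight by the weight reduction
`DeligneSerre1974_span_integralLattice1.of_two_le`, Deligne–Serre Rem. 2.8) and
`HeckeStableRealLattice.linearIndependent_complex`. [cite: DeligneSerreASENS1974, Prop. 2.7 (2.7.2) and Rem. 2.8] -/
theorem DeligneSerre1974_span_integralLattice1_of_forall_heckeStableRealLattice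
    (H : ∀ n : ℕ, Nonempty (HeckeStableRealLattice N (n + 2))) (k : ℤ) :
    DeligneSerre1974_span_integralLattice1 N k :=
  DeligneSerre1974_span_integralLattice1_of_linearIndependent N
    (fun n _ v hv hli ↦ (H n).elim fun Λ ↦ Λ.linearIndependent_complex v hv hli) k

variable (N) in
/-- **The Hecke polynomial of a newform on `Γ₁(N)` of any weight — weight one included — is
integral, granted full Hecke-stable lattices in all weights `≥ 2`** (the named fact
`IsNewform1.exists_map_eq_heckePolynomial` of `NewformGaloisRep`, via
`IsNewform1.exists_map_eq_heckePolynomial_of_span_integralLattice1`). [cite: DeligneSerreASENS1974, §8.2 with Prop. 2.7] -/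
theorem IsNewform1.exists_map_eq_heckePolynomial_of_forall_heckeStableRealLattice
    (H : ∀ n : ℕ, Nonempty (HeckeStableRealLattice N (n + 2))) {k : ℤ}
    {f : CuspForm (Gamma1 N) k} : IsNewform1.exists_map_eq_heckePolynomial (f := f) :=
  IsNewform1.exists_map_eq_heckePolynomial_of_span_integralLattice1
    (DeligneSerre1974_span_integralLattice1_of_forall_heckeStableRealLattice N H k)

/-- **Deligne–Serre 1974, (2.7.4) (`prop27_conj`) from full Hecke-stable lattices for all levels and
all weights `≥ 2`** (via `prop27_conj_of_linearIndependent` of `DeligneSerreSpanHeckeDualityProofs`).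
[cite: DeligneSerreASENS1974, Prop. 2.7 (2.7.4)] -/
theorem DeligneSerre1974.prop27_conj_of_forall_heckeStableRealLattice
    (H : ∀ (N : ℕ) [NeZero N] (n : ℕ), Nonempty (HeckeStableRealLattice N (n + 2))) :
    DeligneSerre1974.prop27_conj :=
  DeligneSerre1974.prop27_conj_of_linearIndependent fun N _ n _ v hv hli ↦
    (H N n).elim fun Λ ↦ Λ.linearIndependent_complex v hv hli

end Lattice

/-! ## 5. The remaining target: the period lattice `periodLatticeK1` has full rank -/

section PeriodLattice

variable {N : ℕ} [NeZero N] {n : ℕ}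

/-- **The Eichler–Shimura period lattice inhabits `HeckeStableRealLattice` as soon as it is the
`ℤ`-span of an `ℝ`-basis of `S_{n+2}(Γ₁(N))^∨`** (its `T_p^∨`- and `⟨d⟩^∨`-stability being the
tree's `periodLatticeK1_fg_stable_separating`, `EichlerShimuraPeriodsGamma1`).  The hypothesis is the
exact `Γ₁(N)`, weight-`(n + 2)` analogue of the discharged `periodHomology_eq_span_basis`
(`Γ₀(N)`, weight `2`, `ModularSymbolsPeriodHomology`): the rank statement of the Eichler–Shimura
isomorphism, Shimura 1971, Thm. 8.4 with Prop. 8.6 (`H¹_P(Γ, D)` is a lattice in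
`H¹_P(Γ, D_ℝ) ≅ S_{n+2}(Γ)`). [cite: Shimura1971, Thm. 8.4 and Prop. 8.6 (§8.4, proof of (3.5.20))] -/
theorem nonempty_heckeStableRealLattice_of_periodLatticeK1_eq_span {m : ℕ}
    (b : Module.Basis (Fin m) ℝ (Module.Dual ℂ (CuspForm (Gamma1 N) (n + 2))))
    (hb : (periodLatticeK1 (N := N) n : Set (Module.Dual ℂ (CuspForm (Gamma1 N) (n + 2)))) =
      Submodule.span ℤ (Set.range b)) :
    Nonempty (HeckeStableRealLattice N (n + 2)) := by
  have hmem : ∀ φ : Module.Dual ℂ (CuspForm (Gamma1 N) (n + 2)),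
      φ ∈ Submodule.span ℤ (Set.range b) ↔ φ ∈ periodLatticeK1 (N := N) n := fun φ ↦ by
    rw [← SetLike.mem_coe, ← hb]
    rfl
  obtain ⟨-, hT, hd, -⟩ := periodLatticeK1_fg_stable_separating N n
  refine ⟨⟨m, b, fun p hp i ↦ ?_, fun d i ↦ ?_⟩⟩
  · exact (hmem _).mpr (hT p hp _ ((hmem _).mp (Submodule.subset_span ⟨i, rfl⟩)))
  · exact (hmem _).mpr (hd (d : ZMod N) _ ((hmem _).mp (Submodule.subset_span ⟨i, rfl⟩)))

variable (N) in
/-- **Deligne–Serre 1974, (2.7.2) in every weight from the rank statement of Eichler–Shimura for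
`Γ₁(N)`**: if for every `n` the period lattice of `S_{n+2}(Γ₁(N))` is the `ℤ`-span of an `ℝ`-basis
of the dual space (Shimura 1971, Thm. 8.4 / Prop. 8.6 — the one statement left unproved in the
tree's reduction of `DeligneSerre1974_span_integralLattice1`), then (2.7.2) holds in every weight.
[cite: DeligneSerreASENS1974, Prop. 2.7 (2.7.2) and Rem. 2.8] -/
theorem DeligneSerre1974_span_integralLattice1_of_forall_periodLatticeK1_eq_span
    (H : ∀ n : ℕ, ∃ (m : ℕ) (b : Module.Basis (Fin m) ℝ (Module.Dual ℂ (CuspForm (Gamma1 N) (n + 2)))),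
      (periodLatticeK1 (N := N) n : Set (Module.Dual ℂ (CuspForm (Gamma1 N) (n + 2)))) =
        Submodule.span ℤ (Set.range b))
    (k : ℤ) : DeligneSerre1974_span_integralLattice1 N k :=
  DeligneSerre1974_span_integralLattice1_of_forall_heckeStableRealLattice N
    (fun n ↦ by
      obtain ⟨m, b, hb⟩ := H n
      exact nonempty_heckeStableRealLattice_of_periodLatticeK1_eq_span b hb) k

end PeriodLattice

end Literature.NumberTheory.EllipticCurves.ModularForms
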